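import Literature.MathematicalPhysics.QuantumManyBody.DiluteBoseGasUpperBoundLocalization
import HarnessLib

/-!
# Basti–Cenatiempo–Schlein 2021, App. A, Lemma A.1 at a fixed shift:
# `⟨Φ_u, HΦ_u⟩ ≤ (1 + Cη) ⟨Ψ, HΨ⟩_per + C (1 + η⁻¹) D² N`

Topic `Literature/MathematicalPhysics/QuantumManyBody`, a companion of
`DiluteBoseGasUpperBoundLocalization.lean` ([BastiCenatiempoSchlein2021, App. A, Lemma A.1],
arXiv:2101.06222 pp. 25–26: the localisation `Φ_u(X) = Ψ(X + u) ∏_{i,k} q(x_{ik})` of an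
`L`-periodic `N`-body wave function into the Dirichlet box `Λ_{L+2ℓ}`).

The source file bounds the energy of `Φ_u` for a fixed shift `u` by `⟨Ψ, HΨ⟩_per` plus ramp terms
carrying the `Lℤ`-periodised indicator `ρ_A(x_{ik} - u_k) = ∑_n 1_A(x_{ik} - u_k - Ln)` of the
ramps `A = [0, 2ℓ] ∪ [L, L + 2ℓ]` (`energyIntegral_cutoffState_le_eta`), and then AVERAGES over
the `M³` discrete shifts (`exists_dirichlet_le_periodic_eta`, gaining the factor `1/M`). Downstream
(the crux line `reward-pays-the-wall` of `AtomisticToContinuum/BoseEinsteinCondensation`, where the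
cut-off state at ONE shift is transported together with its one-particle density matrix) needs the
cruder single-shift form WITHOUT the average, in which the ramp multiplicity is bounded pointwise:

* `tsum_indicator_ramps_sub_le_four` — for `0 < 2ℓ ≤ L` and every `s`,
  `∑_{n ∈ ℤ} 1_{[0,2ℓ] ∪ [L,L+2ℓ]}(s - Ln) ≤ 4` (each window has length `2ℓ ≤ L`, so it holds at
  most two points of `s - Lℤ`; cf. `tsum_indicator_Icc_sub_le_two`, period `2ℓ`);
* `energyIntegral_cutoffState_le_single_shift` — **there is a universal `C` (`C = 12`) such that
  for every `C¹` cut-off profile `q : ℝ → [0,1]` with `∑_m q(t - Lm)² = 1`, `|q'| ≤ D`, `q'`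
  supported on the ramps, every measurable `v ≥ 0`, every `η > 0`, every shift `u` and every
  periodic trial state `Ψ`,
  `⟨Φ_u, HΦ_u⟩ ≤ (1 + Cη) ⟨Ψ, HΨ⟩_per + C (1 + η⁻¹) D² N`** — from
  `energyIntegral_cutoffState_le_eta`, the multiplicity bound, `∫_{cell} |∇Ψ|² ≤ ⟨Ψ, HΨ⟩_per` and
  `∑_{i,k} ∫_{cell} |Ψ|² = 3N` (`Ψ.norm_eq`). This is (A.2) of Lemma A.1 for an arbitrary (not the
  averaged-best) shift, where the paper's `C/(Lℓ) ⟨Ψ, 𝒩Ψ⟩` becomes `C (1 + η⁻¹) D² N` (`D = c/ℓ`)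
  plus the Young excess `Cη ⟨Ψ, HΨ⟩_per` of the `C¹` cross-term treatment of the source file.

## References

* [BastiCenatiempoSchlein2021] G. Basti, S. Cenatiempo, B. Schlein, *A new second-order upper bound
  for the ground state energy of dilute Bose gases*, Forum Math. Sigma 9 (2021) e74
  (arXiv:2101.06222), App. A, Lemma A.1 with (A.1)–(A.5).
-/

noncomputable section

open MeasureTheory
open scoped ENNReal NNReal

namespace Literature.MathematicalPhysics.QuantumManyBody.BoseGas

variable {ℓ L : ℝ}

/-- **Ramp multiplicity for a single shift.** For `0 < 2ℓ ≤ L` and every `s`, at most four lattice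
translates `s - Ln` lie in the ramps `[0, 2ℓ] ∪ [L, L + 2ℓ]`:
`∑_{n ∈ ℤ} 1_{[0,2ℓ] ∪ [L,L+2ℓ]}(s - Ln) ≤ 4` (both windows lie in a translate of `[0, L]`, which
holds at most two points of `s - Lℤ`, `tsum_indicator_Icc_sub_le_two`). [folklore] -/
theorem tsum_indicator_ramps_sub_le_four (hℓ : 0 < ℓ) (hℓL : 2 * ℓ ≤ L) (s : ℝ) :
    ∑' n : ℤ, (Set.Icc 0 (2 * ℓ) ∪ Set.Icc L (L + 2 * ℓ)).indicator (1 : ℝ → ℝ≥0∞) (s - L * n) ≤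
      4 := by
  have hL2 : 0 < L / 2 := by linarith
  -- each window inside a translate of `[0, L]`
  have hsplit : ∀ t : ℝ, (Set.Icc 0 (2 * ℓ) ∪ Set.Icc L (L + 2 * ℓ)).indicator (1 : ℝ → ℝ≥0∞) t ≤
      (Set.Icc 0 L).indicator (1 : ℝ → ℝ≥0∞) t + (Set.Icc 0 L).indicator (1 : ℝ → ℝ≥0∞) (t - L) := by
    intro t
    by_cases ht : t ∈ Set.Icc 0 (2 * ℓ) ∪ Set.Icc L (L + 2 * ℓ)
    · rw [Set.indicator_of_mem ht, Pi.one_apply]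
      rcases ht with h | h
      · have h' : t ∈ Set.Icc 0 L := ⟨h.1, h.2.trans hℓL⟩
        rw [Set.indicator_of_mem h', Pi.one_apply]
        exact le_self_add
      · have h' : t - L ∈ Set.Icc 0 L := ⟨by linarith [h.1], by linarith [h.2]⟩
        rw [Set.indicator_of_mem h', Pi.one_apply]
        exact le_add_self
    · rw [Set.indicator_of_notMem ht]
      exact bot_le
  -- at most two translates in `[0, L]`
  have hkey : ∀ t : ℝ, ∑' n : ℤ, (Set.Icc 0 L).indicator (1 : ℝ → ℝ≥0∞) (t - L * n) ≤ 2 := by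
    intro t
    have h := tsum_indicator_Icc_sub_le_two hL2 t
    have h2 : 2 * (L / 2) = L := by ring
    rw [h2] at h
    exact h
  calc ∑' n : ℤ, (Set.Icc 0 (2 * ℓ) ∪ Set.Icc L (L + 2 * ℓ)).indicator (1 : ℝ → ℝ≥0∞) (s - L * n)
      ≤ ∑' n : ℤ, ((Set.Icc 0 L).indicator (1 : ℝ → ℝ≥0∞) (s - L * n) +
          (Set.Icc 0 L).indicator (1 : ℝ → ℝ≥0∞) (s - L * n - L)) :=
        ENNReal.tsum_le_tsum fun n => hsplit _
    _ = ∑' n : ℤ, (Set.Icc 0 L).indicator (1 : ℝ → ℝ≥0∞) (s - L * n) +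
          ∑' n : ℤ, (Set.Icc 0 L).indicator (1 : ℝ → ℝ≥0∞) ((s - L) - L * n) := by
        rw [ENNReal.tsum_add]
        congr 1
        refine tsum_congr fun n => ?_
        congr 1
        ring
    _ ≤ 2 + 2 := add_le_add (hkey s) (hkey (s - L))
    _ = 4 := by norm_num

/-- **Energy of the cut-off state at a fixed shift (Lemma A.1 (A.2) without the average over
shifts).** There is a universal constant `C` such that for every cut-off profile `q` on the period
`L ≥ 2ℓ > 0` (`C¹`, values in `[0,1]`, partition of unity `∑_m q(t - Lm)² = 1`, slope `|q'| ≤ D`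
supported on the ramps `[0,2ℓ] ∪ [L, L+2ℓ]` — the profile of `exists_smooth_cutoff` has all of
these with `D = c/ℓ`), every measurable `v ≥ 0`, every Young parameter `η > 0`, every shift `u`
and every periodic trial state `Ψ`, the raw energy of `Φ_u(X) = Ψ(X + u) ∏_{i,k} q(x_{ik})`
satisfies `⟨Φ_u, HΦ_u⟩ ≤ (1 + Cη) ⟨Ψ, HΨ⟩_per + C (1 + η⁻¹) D² N`.
Proof: `energyIntegral_cutoffState_le_eta` (kinetic cross term by Young on the ramps,
`interaction ≤ periodicInteraction`, unfolding against the partition of unity), the ramp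
multiplicity `≤ 4` (`tsum_indicator_ramps_sub_le_four`), `∫_{cell} |∇Ψ|² ≤ ⟨Ψ, HΨ⟩_per` and
`∑_{i,k} ∫_{cell} |Ψ|² = 3N`; `C = 12`.
[cite: BastiCenatiempoSchlein2021, App. A, Lemma A.1 (A.2)–(A.5)] -/
theorem energyIntegral_cutoffState_le_single_shift : ∃ C : ℝ, 0 ≤ C ∧
    ∀ (N : ℕ) (ℓ L D : ℝ) (q : ℝ → ℝ) (v : ℝ → ℝ≥0∞) (η : ℝ) (u : Space),
    0 < ℓ → 2 * ℓ ≤ L → Measurable v → 0 < η → ContDiff ℝ 1 q → (∀ t, 0 ≤ q t ∧ q t ≤ 1) →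
    (∀ t, ∑' m : ℤ, ENNReal.ofReal (q (t - L * m) ^ 2) = 1) → (∀ t, |deriv q t| ≤ D) →
    (∀ t, deriv q t ≠ 0 → t ∈ Set.Icc 0 (2 * ℓ) ∪ Set.Icc L (L + 2 * ℓ)) →
    ∀ Ψ : PeriodicTrialState N L,
      ∫⁻ X, kineticDensity (fun X : Config N =>
            Ψ.ψ (X + fun _ => u) * ((∏ p : Fin N × Fin 3, q (X p.1 p.2) : ℝ) : ℂ)) X +
          interaction v X *
            ((‖Ψ.ψ (X + fun _ => u) * ((∏ p : Fin N × Fin 3, q (X p.1 p.2) : ℝ) : ℂ)‖₊ : ℝ≥0∞)) ^ 2 ≤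
        (1 + ENNReal.ofReal (C * η)) * periodicEnergy v Ψ +
          ENNReal.ofReal (C * (1 + η⁻¹) * D ^ 2 * N) := by
  refine ⟨12, by norm_num, fun N ℓ L D q v η u hℓ hℓL hvm hη hq hq01 hpu hD hA Ψ => ?_⟩
  have hL : 0 < L := by linarith
  set A : Set ℝ := Set.Icc 0 (2 * ℓ) ∪ Set.Icc L (L + 2 * ℓ) with hAdef
  have hAm : MeasurableSet A := measurableSet_Icc.union measurableSet_Icc
  -- the ramp integrands
  set f : Fin N → Fin 3 → Config N → ℝ≥0∞ := fun i k X =>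
    ENNReal.ofReal η * ((‖fderiv ℝ Ψ.ψ X (Pi.single i (EuclideanSpace.single k (1 : ℝ)))‖₊ : ℝ≥0∞)) ^ 2 +
      (1 + ENNReal.ofReal η⁻¹) * ENNReal.ofReal (D ^ 2) * ((‖Ψ.ψ X‖₊ : ℝ≥0∞)) ^ 2 with hfdef
  have hG₁m : ∀ (i : Fin N) (k : Fin 3), Measurable fun X : Config N =>
      ((‖fderiv ℝ Ψ.ψ X (Pi.single i (EuclideanSpace.single k (1 : ℝ)))‖₊ : ℝ≥0∞)) ^ 2 :=
    fun i k => ((Ψ.contDiff.continuous_fderiv one_ne_zero).clm_apply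
      continuous_const).measurable.nnnorm.coe_nnreal_ennreal.pow_const _
  have hfm : ∀ i k, Measurable (f i k) := fun i k =>
    ((hG₁m i k).const_mul _).add ((measurable_normSq Ψ.contDiff.continuous).const_mul _)
  -- Step 1: the energy of the cut-off state with the periodised ramp indicator
  have hstep1 : ∫⁻ X, kineticDensity (fun X : Config N =>
        Ψ.ψ (X + fun _ => u) * ((∏ p : Fin N × Fin 3, q (X p.1 p.2) : ℝ) : ℂ)) X +
      interaction v X *
        ((‖Ψ.ψ (X + fun _ => u) * ((∏ p : Fin N × Fin 3, q (X p.1 p.2) : ℝ) : ℂ)‖₊ : ℝ≥0∞)) ^ 2 ≤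
      periodicEnergy v Ψ + ∑ i : Fin N, ∑ k : Fin 3, ∫⁻ X in cellN N L,
        f i k X * ∑' n : ℤ, A.indicator (1 : ℝ → ℝ≥0∞) (X i k - u k - L * n) :=
    energyIntegral_cutoffState_le_eta hL hvm hq hq01 hpu hD hAm hA hη Ψ u
  -- Step 2: the total of the ramp integrands over the cell
  have hT : ∑ i : Fin N, ∑ k : Fin 3, ∫⁻ X in cellN N L, f i k X =
      ENNReal.ofReal η * (∫⁻ X in cellN N L, kineticDensity Ψ.ψ X) +
        3 * N * ((1 + ENNReal.ofReal η⁻¹) * ENNReal.ofReal (D ^ 2)) := by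
    have h1 : ∀ i k, ∫⁻ X in cellN N L, f i k X =
        ENNReal.ofReal η * (∫⁻ X in cellN N L,
          ((‖fderiv ℝ Ψ.ψ X (Pi.single i (EuclideanSpace.single k (1 : ℝ)))‖₊ : ℝ≥0∞)) ^ 2) +
          (1 + ENNReal.ofReal η⁻¹) * ENNReal.ofReal (D ^ 2) := by
      intro i k
      rw [hfdef]
      simp only []
      rw [lintegral_add_left ((hG₁m i k).const_mul _), lintegral_const_mul _ (hG₁m i k),
        lintegral_const_mul _ (measurable_normSq Ψ.contDiff.continuous), Ψ.norm_eq, mul_one]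
    simp only [h1, Finset.sum_add_distrib, Finset.sum_const, Finset.card_univ, Fintype.card_fin,
      nsmul_eq_mul, ← Finset.mul_sum]
    congr 1
    · congr 1
      have h2 : ∀ i : Fin N, ∑ k : Fin 3, ∫⁻ X in cellN N L,
          ((‖fderiv ℝ Ψ.ψ X (Pi.single i (EuclideanSpace.single k (1 : ℝ)))‖₊ : ℝ≥0∞)) ^ 2 =
          ∫⁻ X in cellN N L, ∑ k : Fin 3,
            ((‖fderiv ℝ Ψ.ψ X (Pi.single i (EuclideanSpace.single k (1 : ℝ)))‖₊ : ℝ≥0∞)) ^ 2 :=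
        fun i => (lintegral_finsetSum _ fun k _ => hG₁m i k).symm
      simp only [h2]
      rw [← lintegral_finsetSum _ fun i _ => Finset.measurable_sum _ fun k _ => hG₁m i k]
      rfl
    · push_cast; ring
  -- Step 3: the ramp multiplicity is at most `4`
  have hErr : ∑ i : Fin N, ∑ k : Fin 3, ∫⁻ X in cellN N L,
        f i k X * ∑' n : ℤ, A.indicator (1 : ℝ → ℝ≥0∞) (X i k - u k - L * n) ≤
      4 * (ENNReal.ofReal η * (∫⁻ X in cellN N L, kineticDensity Ψ.ψ X) +
        3 * N * ((1 + ENNReal.ofReal η⁻¹) * ENNReal.ofReal (D ^ 2))) := by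
    rw [← hT, Finset.mul_sum]
    refine Finset.sum_le_sum fun i _ => ?_
    rw [Finset.mul_sum]
    refine Finset.sum_le_sum fun k _ => ?_
    calc ∫⁻ X in cellN N L, f i k X * ∑' n : ℤ, A.indicator (1 : ℝ → ℝ≥0∞) (X i k - u k - L * n)
        ≤ ∫⁻ X in cellN N L, f i k X * 4 := by
          refine lintegral_mono fun X => ?_
          gcongr
          exact tsum_indicator_ramps_sub_le_four hℓ hℓL (X i k - u k)
      _ = 4 * ∫⁻ X in cellN N L, f i k X := by
          rw [lintegral_mul_const _ (hfm i k), mul_comm]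
  -- Step 4: bookkeeping
  have hTle : (∫⁻ X in cellN N L, kineticDensity Ψ.ψ X) ≤ periodicEnergy v Ψ := by
    rw [periodicEnergy, lintegral_add_left (measurable_kineticDensity Ψ.contDiff)]
    exact le_self_add
  have hθ : (1 + ENNReal.ofReal η⁻¹) = ENNReal.ofReal (1 + η⁻¹) := by
    rw [ENNReal.ofReal_add zero_le_one (inv_nonneg.2 hη.le), ENNReal.ofReal_one]
  have hη' : (0 : ℝ) ≤ 1 + η⁻¹ := by positivity
  have hK : 12 * (N : ℝ≥0∞) * ((1 + ENNReal.ofReal η⁻¹) * ENNReal.ofReal (D ^ 2)) =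
      ENNReal.ofReal (12 * (1 + η⁻¹) * D ^ 2 * N) := by
    rw [hθ, ← ENNReal.ofReal_natCast N, ← ENNReal.ofReal_ofNat 12, ← ENNReal.ofReal_mul hη',
      ← ENNReal.ofReal_mul (by norm_num), ← ENNReal.ofReal_mul (by positivity)]
    congr 1
    ring
  have h4 : 4 * ENNReal.ofReal η ≤ ENNReal.ofReal (12 * η) := by
    rw [← ENNReal.ofReal_ofNat 4, ← ENNReal.ofReal_mul (by norm_num)]
    exact ENNReal.ofReal_le_ofReal (by linarith)
  calc _ ≤ _ := hstep1
    _ ≤ periodicEnergy v Ψ + 4 * (ENNReal.ofReal η * (∫⁻ X in cellN N L, kineticDensity Ψ.ψ X) +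
        3 * N * ((1 + ENNReal.ofReal η⁻¹) * ENNReal.ofReal (D ^ 2))) := add_le_add le_rfl hErr
    _ ≤ periodicEnergy v Ψ + 4 * (ENNReal.ofReal η * periodicEnergy v Ψ +
        3 * N * ((1 + ENNReal.ofReal η⁻¹) * ENNReal.ofReal (D ^ 2))) := by gcongr
    _ = (1 + 4 * ENNReal.ofReal η) * periodicEnergy v Ψ +
        12 * (N : ℝ≥0∞) * ((1 + ENNReal.ofReal η⁻¹) * ENNReal.ofReal (D ^ 2)) := by ring
    _ ≤ (1 + ENNReal.ofReal (12 * η)) * periodicEnergy v Ψ +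
        ENNReal.ofReal (12 * (1 + η⁻¹) * D ^ 2 * N) := by
        rw [hK]
        gcongr

end Literature.MathematicalPhysics.QuantumManyBody.BoseGas

end
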